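import Mathlib
import Literature.NumberTheory.LFunctions.MertensFormula
import Summits.Parity.BatemanHorn.Theorems.IsogenyRedeiSplitBlockJacobiSplitMassBound
import HarnessLib

/-!
# Route `IsogenyRedei`, crux `SplitBlockJacobi` (stmt-Parity-11583), line `cofactor-root-discrepancy`:
# Mertens windows and the near-diagonal part of the expected part (helper 2/3 towards `stub_expectedPart`)

The expected part `E_θ(x) = Σ_{(Q,Q′)} (Q|Q′) · 4x/(QQ′)` (prime pairs `Q ≡ Q′ ≡ 1 (mod 4)`,
`x^θ < Q < Q′`, `QQ′ ≤ x² + 1`) is split according to the dyadic scales `i = ⌊log₂ Q⌋`,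
`j = ⌊log₂ Q′⌋`: a pair is FAR when `j ≥ i + 2K + 1` and `2^{i+j+2} ≤ x² + 1` (then it lies in a
full dyadic box inside the pair set, handled by the large sieve in
`IsogenyRedeiSplitBlockJacobiExpectedPartLargeSieve`), and NEAR otherwise.  A near pair has
either `Q < Q′ ≤ 2^{2K+1} Q` or `(x²+1)/(4Q) < Q′ ≤ (x²+1)/Q`, two windows of bounded
logarithmic length, so by Mertens' second theorem with rate (tree:
`Literature.NumberTheory.LFunctions.Mertens.abs_primeRecipSum_sub_le`) the near pairs carry total
weight `Σ 4x/(QQ′) = O(x · K / log x)`.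

Main results:
* `sum_inv_primes_window_le`: `Σ_{A < p ≤ B} 1/p ≤ (log(B/A) + 16)/log A` for `2 ≤ A ≤ B`;
* `sum_inv_primes_windowA_le`, `sum_inv_primes_windowB_le`: the two windows;
* `near_weight_sum_le`: summed over `x^θ < Q ≤ x` with the weight `4x/Q`
  (tree: `SplitMassMiddlePrime.sum_inv_primes_sdiff_le`);
* `abs_nearSum_le`: the near part of `E_θ(x)` is at most
  `12x · (((2K+1) log 2 + 16)/(θ log x) + (log 4 + 16)/log(x/4))`.

No new definitions; everything is proved (no named facts).
-/

noncomputable section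

open Finset
open scoped NumberTheorySymbols

namespace Summit.Parity.BatemanHorn.Cruxes.SplitBlockJacobi.CofactorRootDiscrepancy

open Literature.NumberTheory.LFunctions.Mertens
open Summit.Parity.BatemanHorn.Cruxes.SplitBlockJacobi.SplitMassMiddlePrime

/-- **Mertens' second theorem, differenced over a window.**  For `2 ≤ A ≤ B`,
`Σ_{⌊A⌋ < p ≤ ⌊B⌋, p prime} 1/p ≤ (log(B/A) + 16)/log A`:
indeed the sum is `P(B) − P(A)` with `|P(y) − log log y − M| ≤ 8/log y`, and
`log log B − log log A = log(1 + log(B/A)/log A) ≤ log(B/A)/log A`. [folklore] -/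
theorem sum_inv_primes_window_le {A B : ℝ} (hA : 2 ≤ A) (hAB : A ≤ B) :
    ∑ p ∈ Nat.primesLE ⌊B⌋₊ \ Nat.primesLE ⌊A⌋₊, (p : ℝ)⁻¹ ≤
      (Real.log (B / A) + 16) / Real.log A := by
  have hB : 2 ≤ B := hA.trans hAB
  have hA0 : 0 < A := by linarith
  have hB0 : 0 < B := by linarith
  have hlogA : 0 < Real.log A := Real.log_pos (by linarith)
  have hlogB : 0 < Real.log B := Real.log_pos (by linarith)
  have hlogAB : Real.log A ≤ Real.log B := Real.log_le_log hA0 hAB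
  have hsub : Nat.primesLE ⌊A⌋₊ ⊆ Nat.primesLE ⌊B⌋₊ := Nat.primesLE_mono (Nat.floor_le_floor hAB)
  rw [sum_sdiff_eq_sub hsub]
  change primeRecipSum B - primeRecipSum A ≤ _
  have h1 := (abs_le.mp (abs_primeRecipSum_sub_le hB)).2
  have h2 := (abs_le.mp (abs_primeRecipSum_sub_le hA)).1
  -- `log log B - log log A ≤ log(B/A)/log A`
  have hll : Real.log (Real.log B) - Real.log (Real.log A) ≤ Real.log (B / A) / Real.log A := by
    rw [← Real.log_div hlogB.ne' hlogA.ne', Real.log_div hB0.ne' hA0.ne']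
    have h := Real.log_le_sub_one_of_pos (div_pos hlogB hlogA)
    have e : Real.log B / Real.log A - 1 = (Real.log B - Real.log A) / Real.log A := by
      field_simp
    linarith [e]
  -- `8/log B ≤ 8/log A`
  have hrate : 8 / Real.log B ≤ 8 / Real.log A :=
    div_le_div_of_nonneg_left (by norm_num) hlogA hlogAB
  have e16 : (Real.log (B / A) + 16) / Real.log A =
      Real.log (B / A) / Real.log A + 8 / Real.log A + 8 / Real.log A := by
    field_simp
    ring
  rw [e16]
  linarith

/-- **Window (a).**  For `Q > x^θ` (`x ≥ 2`, `θ > 0`) and `M : ℕ`,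
`Σ_{Q < p ≤ 2^M Q, p prime} 1/p ≤ (M log 2 + 16)/(θ log x)` (window lemma with `B/A = 2^M`,
`log A = log Q ≥ θ log x`). [folklore] -/
theorem sum_inv_primes_windowA_le {θ : ℝ} (hθ : 0 < θ) {x Q : ℕ} (hx : 2 ≤ x) (M : ℕ)
    (hQ : (x : ℝ) ^ θ < Q) :
    ∑ p ∈ Nat.primesLE (2 ^ M * Q) \ Nat.primesLE Q, (p : ℝ)⁻¹ ≤
      ((M : ℝ) * Real.log 2 + 16) / (θ * Real.log x) := by
  have hx1 : (1 : ℝ) < x := by exact_mod_cast hx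
  have hlogx : 0 < Real.log x := Real.log_pos hx1
  have hxθ1 : (1 : ℝ) < (x : ℝ) ^ θ := Real.one_lt_rpow hx1 hθ
  have hQ1 : (1 : ℝ) < Q := hxθ1.trans hQ
  have hQ2 : (2 : ℝ) ≤ Q := by
    have : 1 < Q := by exact_mod_cast hQ1
    exact_mod_cast this
  have hQ0 : (0 : ℝ) < Q := by linarith
  have hM1 : (1 : ℝ) ≤ (2 : ℝ) ^ M := one_le_pow₀ (by norm_num)
  have hAB : (Q : ℝ) ≤ (2 : ℝ) ^ M * Q := by nlinarith
  have h := sum_inv_primes_window_le hQ2 hAB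
  have hfloorB : ⌊(2 : ℝ) ^ M * Q⌋₊ = 2 ^ M * Q := by
    have : ((2 ^ M * Q : ℕ) : ℝ) = (2 : ℝ) ^ M * Q := by push_cast; ring
    rw [← this, Nat.floor_natCast]
  rw [hfloorB, Nat.floor_natCast] at h
  have hBA : (2 : ℝ) ^ M * Q / Q = 2 ^ M := by field_simp
  rw [hBA, Real.log_pow] at h
  refine h.trans ?_
  have hnum : 0 ≤ (M : ℝ) * Real.log 2 + 16 := by positivity
  refine div_le_div_of_nonneg_left hnum (mul_pos hθ hlogx) ?_
  calc θ * Real.log x = Real.log ((x : ℝ) ^ θ) := (Real.log_rpow (by linarith) θ).symm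
    _ ≤ Real.log Q := Real.log_le_log (by positivity) hQ.le

/-- **Window (b).**  For `1 ≤ Q ≤ x`, `x ≥ 8`:
`Σ_{(x²+1)/(4Q) < p ≤ (x²+1)/Q, p prime} 1/p ≤ (log 4 + 16)/log(x/4)` (window lemma with
`B/A = 4`, `A = (x²+1)/(4Q) ≥ x/4 ≥ 2`). [folklore] -/
theorem sum_inv_primes_windowB_le {x Q : ℕ} (hQ : 0 < Q) (hQx : Q ≤ x) (hx : 8 ≤ x) :
    ∑ p ∈ Nat.primesLE ⌊((x : ℝ) ^ 2 + 1) / Q⌋₊ \ Nat.primesLE ⌊((x : ℝ) ^ 2 + 1) / (4 * Q)⌋₊,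
        (p : ℝ)⁻¹ ≤ (Real.log 4 + 16) / Real.log (x / 4) := by
  have hQ0 : (0 : ℝ) < Q := by exact_mod_cast hQ
  have hQx' : (Q : ℝ) ≤ x := by exact_mod_cast hQx
  have hx' : (8 : ℝ) ≤ x := by exact_mod_cast hx
  have hx0 : (0 : ℝ) < x := by linarith
  -- `A = (x²+1)/(4Q) ≥ x/4 ≥ 2`
  have hA : (x : ℝ) / 4 ≤ ((x : ℝ) ^ 2 + 1) / (4 * Q) := by
    rw [div_le_div_iff₀ (by norm_num) (by positivity)]
    nlinarith
  have hA2 : (2 : ℝ) ≤ ((x : ℝ) ^ 2 + 1) / (4 * Q) := le_trans (by linarith) hA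
  have hAB : ((x : ℝ) ^ 2 + 1) / (4 * Q) ≤ ((x : ℝ) ^ 2 + 1) / Q :=
    div_le_div_of_nonneg_left (by positivity) hQ0 (by linarith)
  have h := sum_inv_primes_window_le hA2 hAB
  have hBA : ((x : ℝ) ^ 2 + 1) / Q / (((x : ℝ) ^ 2 + 1) / (4 * Q)) = 4 := by
    field_simp
  rw [hBA] at h
  refine h.trans ?_
  have hnum : 0 ≤ Real.log 4 + 16 := by positivity
  have hlog4 : 0 < Real.log (x / 4) := Real.log_pos (by linarith)
  exact div_le_div_of_nonneg_left hnum hlog4 (Real.log_le_log (by positivity) hA)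

/-- **The near weights, summed over `Q`.**  For `1/2 < θ < 1`, `x ≥ 8`, `x^θ ≥ 2`,
`log x ≥ 24` and `M : ℕ`:
`Σ_{x^θ < Q ≤ x prime} (4x/Q) · Σ_{p ∈ W_a(Q) ∪ W_b(Q)} 1/p
  ≤ 12x · ((M log 2 + 16)/(θ log x) + (log 4 + 16)/log(x/4))`,
with the windows `W_a(Q) = (Q, 2^M Q]`, `W_b(Q) = ((x²+1)/(4Q), (x²+1)/Q]` of primes; uses
`Σ_{x^θ < Q ≤ x} 1/Q ≤ 2(1−θ) + 24/log x ≤ 3` (tree `sum_inv_primes_sdiff_le`). [folklore] -/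
theorem near_weight_sum_le {θ : ℝ} (hθ : 1 / 2 < θ) (hθ1 : θ < 1) {x : ℕ} (M : ℕ) (hx : 8 ≤ x)
    (hxθ : 2 ≤ (x : ℝ) ^ θ) (hlog : 24 ≤ Real.log x) :
    ∑ Q ∈ Nat.primesLE x \ Nat.primesLE ⌊(x : ℝ) ^ θ⌋₊, 4 * (x : ℝ) / Q *
        ∑ p ∈ (Nat.primesLE (2 ^ M * Q) \ Nat.primesLE Q) ∪
            (Nat.primesLE ⌊((x : ℝ) ^ 2 + 1) / Q⌋₊ \ Nat.primesLE ⌊((x : ℝ) ^ 2 + 1) / (4 * Q)⌋₊),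
          (p : ℝ)⁻¹ ≤
      12 * (x : ℝ) * (((M : ℝ) * Real.log 2 + 16) / (θ * Real.log x) +
        (Real.log 4 + 16) / Real.log (x / 4)) := by
  have hθ0 : 0 < θ := by linarith
  have hx2 : 2 ≤ x := le_trans (by norm_num) hx
  have hx0 : (0 : ℝ) ≤ x := Nat.cast_nonneg x
  have hx8 : (8 : ℝ) ≤ x := by exact_mod_cast hx
  have hlogx : 0 < Real.log x := by linarith
  have hlog4 : 0 < Real.log (x / 4) := Real.log_pos (by linarith)
  set Ca : ℝ := ((M : ℝ) * Real.log 2 + 16) / (θ * Real.log x) with hCa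
  set Cb : ℝ := (Real.log 4 + 16) / Real.log (x / 4) with hCb
  have hCa0 : 0 ≤ Ca := by positivity
  have hCb0 : 0 ≤ Cb := by positivity
  -- termwise bound
  have hterm : ∀ Q ∈ Nat.primesLE x \ Nat.primesLE ⌊(x : ℝ) ^ θ⌋₊,
      4 * (x : ℝ) / Q *
        ∑ p ∈ (Nat.primesLE (2 ^ M * Q) \ Nat.primesLE Q) ∪
            (Nat.primesLE ⌊((x : ℝ) ^ 2 + 1) / Q⌋₊ \
              Nat.primesLE ⌊((x : ℝ) ^ 2 + 1) / (4 * Q)⌋₊), (p : ℝ)⁻¹ ≤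
        4 * (x : ℝ) * (Ca + Cb) * (Q : ℝ)⁻¹ := by
    intro Q hQ
    rw [mem_sdiff, Nat.mem_primesLE, Nat.mem_primesLE, not_and_or, not_le] at hQ
    obtain ⟨⟨hQx, hQp⟩, hQθ⟩ := hQ
    have hQθ' : (x : ℝ) ^ θ < Q := by
      rcases hQθ with h | h
      · exact (Nat.floor_lt (by positivity)).mp h
      · exact absurd hQp h
    have ha := sum_inv_primes_windowA_le hθ0 hx2 M hQθ'
    have hb := sum_inv_primes_windowB_le hQp.pos hQx hx
    have hnonneg : ∀ p ∈ (Nat.primesLE (2 ^ M * Q) \ Nat.primesLE Q) ∩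
        (Nat.primesLE ⌊((x : ℝ) ^ 2 + 1) / Q⌋₊ \ Nat.primesLE ⌊((x : ℝ) ^ 2 + 1) / (4 * Q)⌋₊),
        (0 : ℝ) ≤ (p : ℝ)⁻¹ := fun p _ => by positivity
    have hunion := sum_union_inter (s₁ := Nat.primesLE (2 ^ M * Q) \ Nat.primesLE Q)
      (s₂ := Nat.primesLE ⌊((x : ℝ) ^ 2 + 1) / Q⌋₊ \ Nat.primesLE ⌊((x : ℝ) ^ 2 + 1) / (4 * Q)⌋₊)
      (f := fun p : ℕ => (p : ℝ)⁻¹)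
    have hinter := sum_nonneg hnonneg
    have hU : ∑ p ∈ (Nat.primesLE (2 ^ M * Q) \ Nat.primesLE Q) ∪
        (Nat.primesLE ⌊((x : ℝ) ^ 2 + 1) / Q⌋₊ \ Nat.primesLE ⌊((x : ℝ) ^ 2 + 1) / (4 * Q)⌋₊),
          (p : ℝ)⁻¹ ≤ Ca + Cb := by linarith
    have hw : 0 ≤ 4 * (x : ℝ) / Q := by positivity
    calc 4 * (x : ℝ) / Q * _ ≤ 4 * (x : ℝ) / Q * (Ca + Cb) := mul_le_mul_of_nonneg_left hU hw
      _ = 4 * (x : ℝ) * (Ca + Cb) * (Q : ℝ)⁻¹ := by ring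
  refine (sum_le_sum hterm).trans ?_
  rw [← mul_sum]
  have hS := sum_inv_primes_sdiff_le hθ hθ1 hxθ
  have h3 : 2 * (1 - θ) + 24 / Real.log x ≤ 3 := by
    have : 24 / Real.log x ≤ 1 := by rw [div_le_one hlogx]; exact hlog
    linarith
  have hw : 0 ≤ 4 * (x : ℝ) * (Ca + Cb) := by positivity
  calc 4 * (x : ℝ) * (Ca + Cb) * ∑ Q ∈ Nat.primesLE x \ Nat.primesLE ⌊(x : ℝ) ^ θ⌋₊, (Q : ℝ)⁻¹
      ≤ 4 * (x : ℝ) * (Ca + Cb) * 3 := mul_le_mul_of_nonneg_left (hS.trans h3) hw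
    _ = 12 * (x : ℝ) * (Ca + Cb) := by ring

/-- **The near part of the expected part.**  Let `N` be a finite set of NEAR pairs of the
expected part: prime pairs `x^θ < Q < Q′`, `QQ′ ≤ x² + 1`, for which NOT both
`⌊log₂ Q′⌋ ≥ ⌊log₂ Q⌋ + 2K + 1` and `2^{⌊log₂ Q⌋ + ⌊log₂ Q′⌋ + 2} ≤ x² + 1` hold.  Then
`Q′ ∈ (Q, 2^{2K+1} Q]` or `Q′ ∈ ((x²+1)/(4Q), (x²+1)/Q]`, so with `|(Q|Q′)| ≤ 1` and
`near_weight_sum_le`: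
`|Σ_{(Q,Q′) ∈ N} (Q|Q′) · 4x/(QQ′)| ≤ 12x · (((2K+1) log 2 + 16)/(θ log x) + (log 4 + 16)/log(x/4))`
(`1/2 < θ < 1`, `x ≥ 8`, `x^θ ≥ 2`, `log x ≥ 24`). [folklore] -/
theorem abs_nearSum_le :
    ∀ θ : ℝ, 1 / 2 < θ → θ < 1 → ∀ x K : ℕ, 8 ≤ x → 2 ≤ (x : ℝ) ^ θ → 24 ≤ Real.log x →
      ∀ N : Finset (ℕ × ℕ), (∀ q ∈ N, q.1.Prime ∧ q.2.Prime ∧ (x : ℝ) ^ θ < (q.1 : ℝ) ∧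
        q.1 < q.2 ∧ q.1 * q.2 ≤ x ^ 2 + 1 ∧ ¬ (Nat.log 2 q.1 + 2 * K + 1 ≤ Nat.log 2 q.2 ∧
          2 ^ (Nat.log 2 q.1 + Nat.log 2 q.2 + 2) ≤ x ^ 2 + 1)) →
      |∑ q ∈ N, (jacobiSym (q.1 : ℤ) q.2 : ℝ) * (4 * (x : ℝ) / ((q.1 * q.2 : ℕ) : ℝ))| ≤
        12 * (x : ℝ) * ((((2 * K + 1 : ℕ) : ℝ) * Real.log 2 + 16) / (θ * Real.log x) +
          (Real.log 4 + 16) / Real.log (x / 4)) := by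
  intro θ hθ hθ1 x K hx hxθ hlog N hN
  have hx0 : (0 : ℝ) ≤ x := Nat.cast_nonneg x
  have hxθ0 : (0 : ℝ) ≤ (x : ℝ) ^ θ := by positivity
  -- the windows
  set W : ℕ → Finset ℕ := fun Q => (Nat.primesLE (2 ^ (2 * K + 1) * Q) \ Nat.primesLE Q) ∪
    (Nat.primesLE ⌊((x : ℝ) ^ 2 + 1) / Q⌋₊ \ Nat.primesLE ⌊((x : ℝ) ^ 2 + 1) / (4 * Q)⌋₊) with hW
  have hmain := near_weight_sum_le hθ hθ1 (2 * K + 1) hx hxθ hlog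
  -- every near pair has its second coordinate in a window of its first coordinate
  have hwin : ∀ q ∈ N, q.2 ∈ W q.1 := by
    intro q hq
    obtain ⟨hp1, hp2, -, hlt, hprod, hnf⟩ := hN q hq
    have hi : 2 ^ Nat.log 2 q.1 ≤ q.1 := Nat.pow_log_le_self 2 hp1.ne_zero
    have hj : 2 ^ Nat.log 2 q.2 ≤ q.2 := Nat.pow_log_le_self 2 hp2.ne_zero
    have hj' : q.2 < 2 ^ (Nat.log 2 q.2 + 1) := Nat.lt_pow_succ_log_self one_lt_two _
    rw [not_and_or, not_le, not_le] at hnf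
    rw [hW, mem_union]
    rcases hnf with h | h
    · -- window (a): `Q < Q′ ≤ 2^{2K+1} Q`
      left
      rw [mem_sdiff, Nat.mem_primesLE, Nat.mem_primesLE, not_and_or, not_le]
      refine ⟨⟨?_, hp2⟩, Or.inl hlt⟩
      have h1 : 2 ^ (Nat.log 2 q.2 + 1) ≤ 2 ^ (Nat.log 2 q.1 + 2 * K + 1) :=
        Nat.pow_le_pow_right (by norm_num) (by omega)
      have h2 : 2 ^ (Nat.log 2 q.1 + 2 * K + 1) = 2 ^ (2 * K + 1) * 2 ^ Nat.log 2 q.1 := by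
        rw [← pow_add]; ring_nf
      have h3 : 2 ^ (2 * K + 1) * 2 ^ Nat.log 2 q.1 ≤ 2 ^ (2 * K + 1) * q.1 :=
        Nat.mul_le_mul_left _ hi
      omega
    · -- window (b): `(x²+1)/(4Q) < Q′ ≤ (x²+1)/Q`
      right
      have h4 : 2 ^ (Nat.log 2 q.1 + Nat.log 2 q.2 + 2) =
          4 * (2 ^ Nat.log 2 q.1 * 2 ^ Nat.log 2 q.2) := by
        rw [pow_add, pow_add]; ring
      have h5 : 2 ^ Nat.log 2 q.1 * 2 ^ Nat.log 2 q.2 ≤ q.1 * q.2 := Nat.mul_le_mul hi hj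
      have h6 : x ^ 2 + 1 < 4 * (q.1 * q.2) := by omega
      have hq1 : (0 : ℝ) < q.1 := by exact_mod_cast hp1.pos
      rw [mem_sdiff, Nat.mem_primesLE, Nat.mem_primesLE, not_and_or, not_le]
      refine ⟨⟨?_, hp2⟩, Or.inl ?_⟩
      · refine Nat.le_floor ?_
        rw [le_div_iff₀ hq1]
        exact_mod_cast (by nlinarith [hprod] : q.2 * q.1 ≤ x ^ 2 + 1)
      · refine (Nat.floor_lt (by positivity)).mpr ?_
        rw [div_lt_iff₀ (by positivity)]
        exact_mod_cast (by nlinarith [h6] : x ^ 2 + 1 < q.2 * (4 * q.1))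
  -- the first coordinates
  have hmaps : ∀ q ∈ N, q.1 ∈ Nat.primesLE x \ Nat.primesLE ⌊(x : ℝ) ^ θ⌋₊ := by
    intro q hq
    obtain ⟨hp1, -, hθlt, hlt, hprod, -⟩ := hN q hq
    rw [mem_sdiff, Nat.mem_primesLE, Nat.mem_primesLE, not_and_or, not_le]
    refine ⟨⟨?_, hp1⟩, Or.inl ((Nat.floor_lt hxθ0).mpr hθlt)⟩
    have h1 : q.1 * q.1 < q.1 * q.2 := Nat.mul_lt_mul_of_pos_left hlt hp1.pos
    have h2 : q.1 * q.1 ≤ x * x := by nlinarith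
    exact Nat.mul_self_le_mul_self_iff.mp h2
  -- `|(Q|Q′)| ≤ 1`
  have hJ : ∀ q : ℕ × ℕ, |(jacobiSym (q.1 : ℤ) q.2 : ℝ)| ≤ 1 := by
    intro q
    rcases jacobiSym.trichotomy (q.1 : ℤ) q.2 with h | h | h <;> simp [h]
  -- step 1: absolute values
  have hstep1 : |∑ q ∈ N, (jacobiSym (q.1 : ℤ) q.2 : ℝ) * (4 * (x : ℝ) / ((q.1 * q.2 : ℕ) : ℝ))| ≤
      ∑ q ∈ N, 4 * (x : ℝ) / ((q.1 * q.2 : ℕ) : ℝ) := by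
    refine (abs_sum_le_sum_abs _ _).trans (sum_le_sum fun q _ => ?_)
    have hw : (0 : ℝ) ≤ 4 * (x : ℝ) / ((q.1 * q.2 : ℕ) : ℝ) := by positivity
    rw [abs_mul, abs_of_nonneg hw]
    calc |(jacobiSym (q.1 : ℤ) q.2 : ℝ)| * (4 * (x : ℝ) / ((q.1 * q.2 : ℕ) : ℝ))
        ≤ 1 * (4 * (x : ℝ) / ((q.1 * q.2 : ℕ) : ℝ)) := mul_le_mul_of_nonneg_right (hJ q) hw
      _ = _ := one_mul _
  -- step 2: fibre over the first coordinate and enlarge each fibre to the windows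
  have hstep2 : ∑ q ∈ N, 4 * (x : ℝ) / ((q.1 * q.2 : ℕ) : ℝ) ≤
      ∑ Q ∈ Nat.primesLE x \ Nat.primesLE ⌊(x : ℝ) ^ θ⌋₊, 4 * (x : ℝ) / Q *
        ∑ p ∈ W Q, (p : ℝ)⁻¹ := by
    rw [← sum_fiberwise_of_maps_to hmaps]
    refine sum_le_sum fun Q _ => ?_
    have hfib : ∀ q ∈ N.filter (fun q => q.1 = Q),
        4 * (x : ℝ) / ((q.1 * q.2 : ℕ) : ℝ) = 4 * (x : ℝ) / Q * ((q.2 : ℕ) : ℝ)⁻¹ := by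
      intro q hq
      rw [mem_filter] at hq
      rw [← hq.2]
      push_cast
      rw [div_mul_eq_div_div, div_eq_mul_inv]
    rw [sum_congr rfl hfib, ← mul_sum]
    refine mul_le_mul_of_nonneg_left ?_ (by positivity)
    have hinj : Set.InjOn Prod.snd (N.filter (fun q => q.1 = Q) : Set (ℕ × ℕ)) := by
      intro q hq q' hq' h
      rw [Finset.coe_filter] at hq hq'
      exact Prod.ext (hq.2.trans hq'.2.symm) h
    rw [← sum_image (f := fun p : ℕ => (p : ℝ)⁻¹) hinj]
    refine sum_le_sum_of_subset_of_nonneg ?_ fun p _ _ => by positivity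
    intro p hp
    rw [mem_image] at hp
    obtain ⟨q, hq, rfl⟩ := hp
    rw [mem_filter] at hq
    rw [← hq.2]
    exact hwin q hq.1
  exact hstep1.trans (hstep2.trans hmain)

end Summit.Parity.BatemanHorn.Cruxes.SplitBlockJacobi.CofactorRootDiscrepancy
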